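import Summits.Ventures.PercRepro.S2TwelveEightK1NuSix

/-!
# PercRepro — S2: THE CASE `ν = 5` OF THE CELL `(12, 8)` OF `(13, 8)` AT `K₁` (p7, gen 17)

S2ThirteenEightNuFive at `20` points: the nullity-`3` contraction with the cobasis class; at `w = 10`, `#U ≤ 51931` (`m = 226`),
at `w = 9`, `#U ≤ 41985` (`m = 196`); the tail by flats `(10, 9)` = `23751722 / 225`. **`c025_twelve_eight_cfk1_nu_five`**.
Nothing about any cell is claimed. Axioms: standard.
-/

open scoped Matroid

namespace PercRepro

namespace ThmN

open Set

variable {α : Type}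

/-- **The case `ν = 5` of the coloop-free cell `(12, 8)`** (see the module docstring). -/
theorem c025_twelve_eight_cfk1_nu_five (M : Matroid α) [M.Finite]
    (hR : M.eRank = ((12 : ℕ) : ℕ∞)) (hn : M.E.ncard = 12 + 8)
    (hfree : ∀ e ∈ M.E, ∃ A ⊆ M.E \ {e}, e ∉ M.closure A ∧ e ∉ M.closure ((M.E \ {e}) \ A)) (hK : ∀ e, ¬ M.IsColoop e)
    (h6 : ¬ ∃ W ⊆ M.E, W.ncard ≤ 11 ∧ W.encard = M.eRk W + 6)
    (h5 : ∃ W ⊆ M.E, W.ncard ≤ 10 ∧ W.encard = M.eRk W + 5) :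
    ((phiK 13 5 - 2) / 2) * (Matroid.topCount M 12 5 : ℚ) ≤ (Matroid.midCount M 12 5 : ℚ) := by
  classical
  have hd : M.E.encard = M.eRank + ((8 : ℕ) : ℕ∞) := by
    rw [hR, ← M.ground_finite.cast_ncard_eq, hn]
    push_cast
    ring
  obtain ⟨hs3, hs4, hs5⟩ := caps_twelve_eight_cf M hd hn hfree hK
  have hEfin := M.ground_finite
  have hL0 : ∀ e ∈ M.E, ¬ M.IsLoop e := not_isLoop_of_free M hfree
  have hs : ∀ e ∈ M.E, ∀ f ∈ M.E, e ≠ f → M.eRk {e, f} = 2 := by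
    intro e he f hf hef
    have h2 : (2 : ℕ∞) ≤ M.eRk {e, f} :=
      two_le_eRk_of_two_le_ncard_of_free M hfree (pair_subset he hf) (by rw [ncard_pair hef])
    have h3 : M.eRk {e, f} ≤ 2 := by
      have := M.eRk_le_encard {e, f}
      rwa [encard_pair hef] at this
    exact le_antisymm h3 h2
  have hC1 : ∀ L ⊆ M.E, M.eRk L = 2 → L.ncard ≤ 3 :=
    fun L hL hr => ncard_le_three_of_eRk_two M hs hfree hL hr
  have hflat : ∀ X ⊆ M.E, M.eRk X ≤ 5 → X.ncard ≤ 10 := fun X hX hr => by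
    have := S2.ncard_le_of_eRk_le_of_not_nullity M 6 11 (by norm_num) h6 hX (r := 5) (by norm_num) (by exact_mod_cast hr)
    omega
  have hflat' : ∀ X ⊆ M.E, M.eRk X ≤ 4 → X.ncard ≤ 9 := fun X hX hr => by
    have := S2.ncard_le_of_eRk_le_of_not_nullity M 6 11 (by norm_num) h6 hX (r := 4) (by norm_num) (by exact_mod_cast hr)
    omega
  -- the set `W`
  obtain ⟨W, hW, hWn, hWk⟩ := h5
  have hWfin : W.Finite := hEfin.subset hW
  have hWne : M.eRk W ≠ ⊤ := ((M.eRk_le_encard W).trans_lt hWfin.encard_lt_top).ne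
  obtain ⟨r, hr⟩ := ENat.ne_top_iff_exists.1 hWne
  have hWr : W.ncard = r + 5 := by
    have h := hWk
    rw [← hr, ← hWfin.cast_ncard_eq] at h
    exact_mod_cast h
  have hr4 : 4 ≤ r := by
    by_contra hlt
    push Not at hlt
    have h3 : M.eRk W ≤ 3 := by rw [← hr]; exact_mod_cast (by omega : r ≤ 3)
    have h6' := ncard_le_six_of_eRk_le_three_of_free M hfree hW h3
    have h2 : M.eRk W ≤ 2 := by rw [← hr]; exact_mod_cast (by omega : r ≤ 2)
    have h3' := S2.ncard_le_three_of_eRk_le_two M hs hC1 hW h2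
    omega
  have hr5 : r ≤ 5 := by omega
  -- `W` is a flat
  have hWcl : M.closure W = W := by
    refine le_antisymm ?_ (M.subset_closure W hW)
    intro x hx
    by_contra hxW
    have hxE : x ∈ M.E := M.closure_subset_ground W hx
    apply h6
    refine ⟨insert x W, Set.insert_subset hxE hW, ?_, ?_⟩
    · rw [Set.ncard_insert_of_notMem hxW hWfin]; omega
    · rw [Set.encard_insert_of_notMem hxW, ← M.eRk_closure_eq, M.closure_insert_eq_of_mem_closure hx,
        M.eRk_closure_eq, hWk]
      ring
  -- the contraction `M ／ W`
  have hNE : (M ／ W).E = M.E \ W := Matroid.contract_ground M W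
  have hRW : (M.E \ W).ncard = 20 - (r + 5) := by
    rw [Set.ncard_sdiff hW hWfin, hn, hWr]
  have hNEcard : (M ／ W).E.ncard = 20 - (r + 5) := by rw [hNE, hRW]
  have hNL : ∀ e ∈ (M ／ W).E, ¬ (M ／ W).IsLoop e := S2.contract_not_isLoop_of_closure_eq M hWcl
  have hν : (M ／ W)✶.eRank = ((3 : ℕ) : ℕ∞) := by
    have h := S2.eRank_dual_contract_add M hW
    rw [hR, ← hr, ← M.ground_finite.sdiff.cast_ncard_eq, hRW] at h
    have h2 : ((r : ℕ) : ℕ∞) + ((20 - (r + 5) : ℕ) : ℕ∞) = ((3 : ℕ) : ℕ∞) + ((12 : ℕ) : ℕ∞) := by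
      norm_cast
      omega
    rw [h2] at h
    exact WithTop.add_right_cancel (WithTop.natCast_ne_top 12) h
  -- the counts on `N`
  have hD2N := S2.ncard_dep_two_le (M ／ W) hν hNL
  have hD3N := S2.ncard_dep_three_le (M ／ W) hν hNL
  rw [hNEcard] at hD3N
  norm_num [Nat.choose] at hD2N hD3N
  have hT3four := S2.ncard_allpairs_dep_three_le_four (M ／ W) hNL hD2N
  have hD1N : {X : Set α | X ⊆ (M ／ W).E ∧ X.ncard = 1 ∧ (M ／ W).Dep X}.ncard = 0 := by
    rw [Set.ncard_eq_zero ((M ／ W).ground_finite.finite_subsets.subset (fun X hX => hX.1)), Set.eq_empty_iff_forall_notMem]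
    rintro X ⟨hXE, hX1, hXdep⟩
    obtain ⟨e, rfl⟩ := Set.ncard_eq_one.1 hX1
    exact hNL e (hXE (Set.mem_singleton e)) (Matroid.singleton_dep.1 hXdep)
  have hD0N : {X : Set α | X ⊆ (M ／ W).E ∧ X.ncard = 0 ∧ (M ／ W).Dep X}.ncard = 0 := by
    rw [Set.ncard_eq_zero ((M ／ W).ground_finite.finite_subsets.subset (fun X hX => hX.1)), Set.eq_empty_iff_forall_notMem]
    rintro X ⟨hXE, hX0, hXdep⟩
    rw [Set.ncard_eq_zero ((M ／ W).ground_finite.subset hXE)] at hX0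
    subst hX0
    exact hXdep.not_indep (M ／ W).empty_indep
  -- the counts on `W`
  have hD3W := S2.ncard_dep_three_mul_three_le M hs hC1 hW
  have hR42 := S2.ncard_four_eRk_le_two_eq_zero M hs hC1 hW
  have hDep4 := S2.ncard_dep_four_le_ncard_indep_three M hfree hs hC1 hW
  have hR53 := S2.ncard_five_eRk_le_three_mul_five_le M hfree hs hC1 hW
  have hR63 := S2.ncard_six_eRk_le_three_mul_fifteen_le M hfree hs hC1 hW
  have hR52 : {T : Set α | T ⊆ W ∧ T.ncard = 5 ∧ M.eRk T ≤ 2}.ncard = 0 := by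
    rw [Set.ncard_eq_zero (hWfin.finite_subsets.subset (fun T hT => hT.1)), Set.eq_empty_iff_forall_notMem]
    rintro T ⟨hTW, hT5, hTr⟩
    have := S2.ncard_le_three_of_eRk_le_two M hs hC1 (hTW.trans hW) hTr
    omega
  have hF5crude : {T : Set α | T ⊆ W ∧ T.ncard = 5 ∧ M.Dep T ∧ M.Indep (W \ T)}.ncard ≤ W.ncard.choose 5 := by
    rw [← S2.ncard_subsets_ncard_eq W hWfin 5]
    exact Set.ncard_le_ncard (fun T hT => ⟨hT.1, hT.2.1⟩) (hWfin.finite_subsets.subset (fun T hT => hT.1))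
  rw [hWr] at hD3W
  have hR43le : {T : Set α | T ⊆ W ∧ T.ncard = 4 ∧ M.eRk T = 3}.ncard ≤ {T : Set α | T ⊆ W ∧ T.ncard = 4 ∧ M.Dep T}.ncard := by
    refine Set.ncard_le_ncard ?_ (hWfin.finite_subsets.subset (fun T hT => hT.1))
    rintro T ⟨hTW, hT4, hTr⟩
    refine ⟨hTW, hT4, ?_⟩
    rw [← Matroid.eRk_lt_encard_iff_dep_of_finite (hWfin.subset hTW) (hTW.trans hW), hTr,
      ← (hWfin.subset hTW).cast_ncard_eq, hT4]
    norm_num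
  -- the splits
  have hsplit : ∀ j, {T : Set α | T ⊆ W ∧ T.ncard = j ∧ M.Indep T}.ncard + {T : Set α | T ⊆ W ∧ T.ncard = j ∧ M.Dep T}.ncard ≤ W.ncard.choose j := by
    intro j
    rw [← S2.ncard_subsets_ncard_eq W hWfin j, ← Set.ncard_union_eq (Set.disjoint_left.2 (fun T h1 h2 => h2.2.2.not_indep h1.2.2))
      (hWfin.finite_subsets.subset (fun T hT => hT.1)) (hWfin.finite_subsets.subset (fun T hT => hT.1))]
    exact Set.ncard_le_ncard (Set.union_subset (fun T hT => ⟨hT.1, hT.2.1⟩) (fun T hT => ⟨hT.1, hT.2.1⟩)) (hWfin.finite_subsets.subset (fun T hT => hT.1))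
  have hsplit4 : {T : Set α | T ⊆ W ∧ T.ncard = 4 ∧ M.Indep T}.ncard + {T : Set α | T ⊆ W ∧ T.ncard = 4 ∧ M.eRk T = 3}.ncard ≤ W.ncard.choose 4 := by
    rw [← S2.ncard_subsets_ncard_eq W hWfin 4, ← Set.ncard_union_eq (Set.disjoint_left.2 (fun T h1 h2 => by
        have h := h1.2.2.eRk_eq_encard
        rw [h2.2.2, ← (hWfin.subset h1.1).cast_ncard_eq, h1.2.1] at h
        norm_num at h))
      (hWfin.finite_subsets.subset (fun T hT => hT.1)) (hWfin.finite_subsets.subset (fun T hT => hT.1))]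
    exact Set.ncard_le_ncard (Set.union_subset (fun T hT => ⟨hT.1, hT.2.1⟩) (fun T hT => ⟨hT.1, hT.2.1⟩)) (hWfin.finite_subsets.subset (fun T hT => hT.1))
  have hsplit5 : {T : Set α | T ⊆ W ∧ T.ncard = 5 ∧ 4 ≤ M.eRk T}.ncard + {T : Set α | T ⊆ W ∧ T.ncard = 5 ∧ M.eRk T ≤ 3}.ncard ≤ W.ncard.choose 5 := by
    rw [← S2.ncard_subsets_ncard_eq W hWfin 5, ← Set.ncard_union_eq (Set.disjoint_left.2 (fun T h1 h2 => by
        have := h1.2.2.trans h2.2.2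
        norm_num at this))
      (hWfin.finite_subsets.subset (fun T hT => hT.1)) (hWfin.finite_subsets.subset (fun T hT => hT.1))]
    exact Set.ncard_le_ncard (Set.union_subset (fun T hT => ⟨hT.1, hT.2.1⟩) (fun T hT => ⟨hT.1, hT.2.1⟩)) (hWfin.finite_subsets.subset (fun T hT => hT.1))
  have hsplit6 : {T : Set α | T ⊆ W ∧ T.ncard = 6 ∧ 4 ≤ M.eRk T}.ncard + {T : Set α | T ⊆ W ∧ T.ncard = 6 ∧ M.eRk T ≤ 3}.ncard ≤ W.ncard.choose 6 := by
    rw [← S2.ncard_subsets_ncard_eq W hWfin 6, ← Set.ncard_union_eq (Set.disjoint_left.2 (fun T h1 h2 => by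
        have := h1.2.2.trans h2.2.2
        norm_num at this))
      (hWfin.finite_subsets.subset (fun T hT => hT.1)) (hWfin.finite_subsets.subset (fun T hT => hT.1))]
    exact Set.ncard_le_ncard (Set.union_subset (fun T hT => ⟨hT.1, hT.2.1⟩) (fun T hT => ⟨hT.1, hT.2.1⟩)) (hWfin.finite_subsets.subset (fun T hT => hT.1))
  have hsub6 : {T : Set α | T ⊆ W ∧ T.ncard = 6 ∧ M.Dep T}.ncard ≤ W.ncard.choose 6 := by
    rw [← S2.ncard_subsets_ncard_eq W hWfin 6]
    exact Set.ncard_le_ncard (fun T hT => ⟨hT.1, hT.2.1⟩) (hWfin.finite_subsets.subset (fun T hT => hT.1))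
  have hsub5d : {T : Set α | T ⊆ W ∧ T.ncard = 5 ∧ M.Dep T}.ncard ≤ W.ncard.choose 5 := by
    rw [← S2.ncard_subsets_ncard_eq W hWfin 5]
    exact Set.ncard_le_ncard (fun T hT => ⟨hT.1, hT.2.1⟩) (hWfin.finite_subsets.subset (fun T hT => hT.1))
  -- the hitting bounds: a top set meets `W` in `≥ |B| − 2` points
  have hhit : ∀ B, B ⊆ M.E → M.eRk (M.E \ B) = M.eRank → B.ncard + 5 ≤ 8 + (B ∩ W).ncard := by
    intro B hBE hBs
    have h := S2.encard_add_le_of_spanning_compl_of_nullity M hBE hW hBs hd hWk hWne (by rw [hR]; exact WithTop.natCast_ne_top 12)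
    rw [Set.inter_comm, ← (hEfin.subset hBE).cast_ncard_eq, ← ((hEfin.subset hBE).inter_of_left W).cast_ncard_eq] at h
    exact_mod_cast h
  have hhit6 : ∀ B, B ⊆ M.E → B.ncard = 6 → M.eRk B = 5 → M.eRk (M.E \ B) = M.eRank → 3 ≤ (B ∩ W).ncard := by
    intro B hBE hB6 _ hBs
    have := hhit B hBE hBs
    omega
  have hhit7 : ∀ B, B ⊆ M.E → B.ncard = 7 → M.eRk B = 5 → M.eRk (M.E \ B) = M.eRank → 4 ≤ (B ∩ W).ncard := by
    intro B hBE hB7 _ hBs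
    have := hhit B hBE hBs
    omega
  have hhit8 : ∀ B, B ⊆ M.E → B.ncard = 8 → M.eRk B = 5 → M.eRk (M.E \ B) = M.eRank → 5 ≤ (B ∩ W).ncard := by
    intro B hBE hB8 _ hBs
    have := hhit B hBE hBs
    omega
  -- the top count: `5`-, `6`-, `7`- and `8`-sets
  have hU1 := S2.topCount_le_ncard_compl_spanning (M := M) hR hd 5
  simp only [Nat.cast_ofNat] at hU1
  have hF5 : {B : Set α | B ⊆ M.E ∧ B.ncard = 5 ∧ M.eRk (M.E \ B) = M.eRank}.Finite := hEfin.finite_subsets.subset (fun B hB => hB.1)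
  have hF6 : {B : Set α | B ⊆ M.E ∧ B.ncard = 6 ∧ M.eRk B = 5 ∧ M.eRk (M.E \ B) = M.eRank}.Finite := hEfin.finite_subsets.subset (fun B hB => hB.1)
  have hF7 : {B : Set α | B ⊆ M.E ∧ B.ncard = 7 ∧ M.eRk B = 5 ∧ M.eRk (M.E \ B) = M.eRank}.Finite := hEfin.finite_subsets.subset (fun B hB => hB.1)
  have hF8 : {B : Set α | B ⊆ M.E ∧ B.ncard = 8 ∧ M.eRk B = 5 ∧ M.eRk (M.E \ B) = M.eRank}.Finite := hEfin.finite_subsets.subset (fun B hB => hB.1)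
  have hsplitU : {B : Set α | B ⊆ M.E ∧ M.eRk B = 5 ∧ B.ncard ≤ 8 ∧ M.eRk (M.E \ B) = M.eRank}.ncard ≤
      {B : Set α | B ⊆ M.E ∧ B.ncard = 5 ∧ M.eRk (M.E \ B) = M.eRank}.ncard +
      {B : Set α | B ⊆ M.E ∧ B.ncard = 6 ∧ M.eRk B = 5 ∧ M.eRk (M.E \ B) = M.eRank}.ncard +
      {B : Set α | B ⊆ M.E ∧ B.ncard = 7 ∧ M.eRk B = 5 ∧ M.eRk (M.E \ B) = M.eRank}.ncard +
      {B : Set α | B ⊆ M.E ∧ B.ncard = 8 ∧ M.eRk B = 5 ∧ M.eRk (M.E \ B) = M.eRank}.ncard := by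
    refine le_trans (Set.ncard_le_ncard ?_ (((hF5.union hF6).union hF7).union hF8)) ?_
    · rintro B ⟨hBE, hB5, hB8, hBs⟩
      have hBfin : B.Finite := hEfin.subset hBE
      have h5le : 5 ≤ B.ncard := by
        have := M.eRk_le_encard B
        rw [hB5, ← hBfin.cast_ncard_eq] at this
        exact_mod_cast this
      rcases (show B.ncard = 5 ∨ B.ncard = 6 ∨ B.ncard = 7 ∨ B.ncard = 8 by omega) with h | h | h | h
      · exact Or.inl (Or.inl (Or.inl ⟨hBE, h, hBs⟩))
      · exact Or.inl (Or.inl (Or.inr ⟨hBE, h, hB5, hBs⟩))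
      · exact Or.inl (Or.inr ⟨hBE, h, hB5, hBs⟩)
      · exact Or.inr ⟨hBE, h, hB5, hBs⟩
    · have h1 := Set.ncard_union_le ({B : Set α | B ⊆ M.E ∧ B.ncard = 5 ∧ M.eRk (M.E \ B) = M.eRank} ∪
        {B : Set α | B ⊆ M.E ∧ B.ncard = 6 ∧ M.eRk B = 5 ∧ M.eRk (M.E \ B) = M.eRank} ∪
        {B : Set α | B ⊆ M.E ∧ B.ncard = 7 ∧ M.eRk B = 5 ∧ M.eRk (M.E \ B) = M.eRank})
        {B : Set α | B ⊆ M.E ∧ B.ncard = 8 ∧ M.eRk B = 5 ∧ M.eRk (M.E \ B) = M.eRank}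
      have h2 := Set.ncard_union_le ({B : Set α | B ⊆ M.E ∧ B.ncard = 5 ∧ M.eRk (M.E \ B) = M.eRank} ∪
        {B : Set α | B ⊆ M.E ∧ B.ncard = 6 ∧ M.eRk B = 5 ∧ M.eRk (M.E \ B) = M.eRank})
        {B : Set α | B ⊆ M.E ∧ B.ncard = 7 ∧ M.eRk B = 5 ∧ M.eRk (M.E \ B) = M.eRank}
      have h3 := Set.ncard_union_le {B : Set α | B ⊆ M.E ∧ B.ncard = 5 ∧ M.eRk (M.E \ B) = M.eRank}
        {B : Set α | B ⊆ M.E ∧ B.ncard = 6 ∧ M.eRk B = 5 ∧ M.eRk (M.E \ B) = M.eRank}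
      omega
  have htop5 := S2.ncard_spanning_compl_le_of_nullity M hW hd hWk (m := 5)
  have htop6 := S2.ncard_top_le_sum_contract M hW 6 3 (by norm_num) hhit6
  have htop7 := S2.ncard_top_seven_le_contract M hW hhit7
  have htop8 := S2.ncard_top_eight_le_contract_compl M hR hn hW hWcl hhit8
  rw [Finset.sum_Icc_succ_top (by norm_num : 3 ≤ 6), Finset.sum_Icc_succ_top (by norm_num : 3 ≤ 5),
    Finset.sum_Icc_succ_top (by norm_num : 3 ≤ 4), Finset.Icc_self, Finset.sum_singleton] at htop6
  simp only [show (6 : ℕ) - 3 = 3 from rfl, show (6 : ℕ) - 4 = 2 from rfl, show (6 : ℕ) - 5 = 1 from rfl,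
    show (6 : ℕ) - 6 = 0 from rfl] at htop6
  have hsubT3 : {X : Set α | X ⊆ (M ／ W).E ∧ X.ncard = 3 ∧ ∀ x ∈ X, ∀ y ∈ X, x ≠ y → (M ／ W).Dep {x, y}}.ncard ≤
      {X : Set α | X ⊆ (M ／ W).E ∧ X.ncard = 3 ∧ (M ／ W).Dep X}.ncard := by
    refine Set.ncard_le_ncard ?_ ((M ／ W).ground_finite.finite_subsets.subset (fun X hX => hX.1))
    rintro X ⟨hXE, hX3, hpairs⟩
    refine ⟨hXE, hX3, ?_⟩
    obtain ⟨a, b, c, hab, -, -, rfl⟩ := Set.ncard_eq_three.1 hX3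
    exact (hpairs a (Set.mem_insert a _) b (Set.mem_insert_of_mem a (Set.mem_insert b _)) hab).superset
      (Set.pair_subset (Set.mem_insert a _) (Set.mem_insert_of_mem a (Set.mem_insert b _))) hXE
  rw [hNE] at hD1N hD0N hsubT3 hT3four
  rw [hD1N, hD0N, hRW] at htop6
  rw [hRW] at htop7 htop8
  -- the tail and the spanning count
  have hA := ncard_eRk_le_five_le_flats M 12 8 (by norm_num) hR hn hfree 10 9 hflat hflat' (by norm_num) (by norm_num)
    (by norm_num) (by norm_num) 13 86 534 hs3 hs4 hs5
  have hA' : ({X : Set α | X ⊆ M.E ∧ M.eRk X ≤ 5}.ncard : ℚ) ≤ 23751722 / 225 := by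
    norm_num [Finset.sum_range_succ, Nat.choose] at hA
    linarith
  have hS := S2.ncard_spanning_le_of_nullity M hW hd hWk
  rw [hn] at hS htop5
  have cellA : ∀ (U S m : ℕ) (A : ℚ), Matroid.topCount M 12 5 ≤ U → ({X : Set α | X ⊆ M.E ∧ M.eRk X ≤ 5}.ncard : ℚ) ≤ A →
      {X : Set α | X ⊆ M.E ∧ M.eRk X = M.eRank}.ncard ≤ S → m ≤ 1024 →
      1024 * (U : ℚ) ≤ ((1024 - m : ℕ) : ℚ) * 2 ^ (8 - 5) * (10219 : ℚ) →
      (1024 : ℚ) * (A + (S : ℚ)) ≤ (m : ℚ) * 2 ^ 20 → ((phiK 13 5 - 2) / 2) * (Matroid.topCount M 12 5 : ℚ) ≤ (Matroid.midCount M 12 5 : ℚ) := by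
    intro U S m A hU hA hS hm hpoly htail
    exact c025_core_five_cell_of_counts_xqictq5g M 12 8 (by norm_num) hR hn U hU A hA S hS
      10219 (by norm_num) ((phiK 13 5 - 2) / 2) (by rw [phiK_thirteen_five]; norm_num) ⟨m, hm, hpoly, htail⟩
  have hmul : ∀ (a b c : ℕ), b ≤ c → a * b ≤ a * c := fun a b c h => Nat.mul_le_mul_left a h
  rcases (show r = 4 ∨ r = 5 by omega) with hr4e | hr5e
  · -- `w = 9`
    subst hr4e
    have hw : W.ncard = 9 := hWr
    have hF5 : {T : Set α | T ⊆ W ∧ T.ncard = 5 ∧ M.Dep T ∧ M.Indep (W \ T)}.ncard ≤ 126 := by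
      refine hF5crude.trans ?_
      rw [hw]
      decide
    rw [hw] at htop5 hsplit hsplit4 hsplit5 hsplit6 hsub6 hsub5d htop7 htop8 hS
    norm_num [Finset.sum_Icc_succ_top, Nat.choose] at htop5 hS hsplit hsplit4 hsplit5 hsplit6 hsub6 hsub5d hD3W htop6 htop7 htop8 hD3N hsubT3 hT3four hDep4 hR53 hR63 hR43le hF5
    have h3 := hsplit 3
    have h4 := hsplit 4
    have h5' := hsplit 5
    have h6' := hsplit 6
    norm_num [Nat.choose] at h3 h4 h5' h6'
    have hS' : {X : Set α | X ⊆ M.E ∧ M.eRk X = M.eRank}.ncard ≤ 94693 := by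
      refine hS.trans ?_
      decide
    have hU' : Matroid.topCount M 12 5 ≤ 41985 := by
      have m1 := hmul {T : Set α | T ⊆ W ∧ T.ncard = 3 ∧ M.Indep T}.ncard _ _ hD3N
      have m2 := hmul {T : Set α | T ⊆ W ∧ T.ncard = 4 ∧ M.Indep T}.ncard _ _ hD2N
      have m3 := hmul {T : Set α | T ⊆ W ∧ T.ncard = 4 ∧ M.Indep T}.ncard _ _ hT3four
      have m8 := hmul {T : Set α | T ⊆ W ∧ T.ncard = 5 ∧ M.Dep T ∧ M.Indep (W \ T)}.ncard _ _ hD3N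
      have m5 := hmul {T : Set α | T ⊆ W ∧ T.ncard = 4 ∧ M.eRk T = 3}.ncard _ _ hD3N
      have m6 := hmul {T : Set α | T ⊆ W ∧ T.ncard = 5 ∧ 4 ≤ M.eRk T}.ncard _ _ hD2N
      have m7 := hmul {T : Set α | T ⊆ W ∧ T.ncard = 6 ∧ 4 ≤ M.eRk T}.ncard _ _ hD2N
      rw [hR42] at htop7
      rw [hR52] at htop8
      omega
    exact cellA 41985 94693 196 (23751722 / 225) hU' hA' hS' (by norm_num) (by norm_num) (by norm_num)
  · -- `w = 10`
    subst hr5e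
    have hw : W.ncard = 10 := hWr
    have hF5 := S2.ncard_dep_compl_indep_five_le M hW hw
    rw [hw] at htop5 hsplit hsplit4 hsplit5 hsplit6 hsub6 hsub5d htop7 htop8 hS
    norm_num [Finset.sum_Icc_succ_top, Nat.choose] at htop5 hS hsplit hsplit4 hsplit5 hsplit6 hsub6 hsub5d hD3W htop6 htop7 htop8 hD3N hsubT3 hT3four hDep4 hR53 hR63 hR43le hF5
    have h3 := hsplit 3
    have h4 := hsplit 4
    have h5' := hsplit 5
    have h6' := hsplit 6
    norm_num [Nat.choose] at h3 h4 h5' h6'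
    have hS' : {X : Set α | X ⊆ M.E ∧ M.eRk X = M.eRank}.ncard ≤ 125413 := by
      refine hS.trans ?_
      decide
    have hU' : Matroid.topCount M 12 5 ≤ 51931 := by
      have m1 := hmul {T : Set α | T ⊆ W ∧ T.ncard = 3 ∧ M.Indep T}.ncard _ _ hD3N
      have m2 := hmul {T : Set α | T ⊆ W ∧ T.ncard = 4 ∧ M.Indep T}.ncard _ _ hD2N
      have m3 := hmul {T : Set α | T ⊆ W ∧ T.ncard = 4 ∧ M.Indep T}.ncard _ _ hT3four
      have m8 := hmul {T : Set α | T ⊆ W ∧ T.ncard = 5 ∧ M.Dep T ∧ M.Indep (W \ T)}.ncard _ _ hD3N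
      have m5 := hmul {T : Set α | T ⊆ W ∧ T.ncard = 4 ∧ M.eRk T = 3}.ncard _ _ hD3N
      have m6 := hmul {T : Set α | T ⊆ W ∧ T.ncard = 5 ∧ 4 ≤ M.eRk T}.ncard _ _ hD2N
      have m7 := hmul {T : Set α | T ⊆ W ∧ T.ncard = 6 ∧ 4 ≤ M.eRk T}.ncard _ _ hD2N
      rw [hR42] at htop7
      rw [hR52] at htop8
      omega
    exact cellA 51931 125413 226 (23751722 / 225) hU' hA' hS' (by norm_num) (by norm_num) (by norm_num)

end ThmN

end PercRepro
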